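import Mathlib
import HarnessLib
import Summits.SmoothPoincare4.SmoothPoincare4.Theses.RootDecompY

/-!
# Line «unimax» for the crux `GscCP2Cancellation` (stmt-SmoothPoincare4-32280, route-SmoothPoincare4-RootDecompY rev 2, file rank 403;
declared residual of the lens-4 g9 «UnimaxNormalForm» split of CP2CancellationOne #17708; species R).

Writer W1 form of the lens BC3 skeleton HOME/decomp-sp4-lens-4/gen9/bc/BC3_birth_GscCP2Cancellation.lean (rc 0, sorries = stubs = 3,
stub probes stub → UC / stub → S must-fail 6/6, gen9/bc/BC3_results.txt): the local copy of UC and the binder-form composition are REMOVED;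
`GscCP2Cancellation_of` proves the ROUTE DECL `Summit.SmoothPoincare4.SmoothPoincare4.Theses.RootDecompY.GscCP2Cancellation` BY NAME, hypothesis-free,
from the three registered stubs (statements byte-identical to the lens stubs, over tree declarations only):
* `stub_floor_le_one` — rows n ≤ 1 (n = 0: S⁴ = Σ_∅, kernel §5; n = 1: Gabai Property R, gen9/FloorOne.lean modulo tree facts) — FLOOR;
* `stub_row_two` — row n = 2 (two-component R-links whose sphere dissolves at rank one; GST Prop 3.2 «the unknot has Property 2R» + census T-UNIMAX2) — LOAD-BEARING, instrumented;
* `stub_stable_descent` — n ≥ 3: a dissolvable R-link sphere admits an R-link presentation with ≤ 2 components (E-shaped re-presentation; critic 850 species note: instruments belong on row two and direct rows n ≥ 3, not here).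
Exactness UC ⟺ stub₁ ∧ stub₂ ∧ stub₃ is `gscCP2Cancellation_iff_line` in the lens kernel gen9/UnimaxNormalForm.lean §7.
-/

set_option linter.dupNamespace false

namespace Summit.SmoothPoincare4.SmoothPoincare4.Cruxes.GscCP2Cancellation.Unimax

open scoped Manifold ContDiff
open Literature.Topology.FourManifolds

/-- rows n ≤ 1 (Property R floor). -/
theorem stub_floor_le_one : open scoped ContDiff in ∀ (n : ℕ), n ≤ 1 → ∀ (L : Literature.Topology.FourManifolds.FramedLink (Fin n)) (M : Type) [TopologicalSpace M] [T2Space M] [SecondCountableTopology M] [ChartedSpace (EuclideanSpace ℝ (Fin 4)) M] [IsManifold (𝓡 4) ∞ M], Literature.Topology.FourManifolds.IsRLinkSphere M L → (∃ (P : Type) (_ : TopologicalSpace P) (_ : T2Space P) (_ : SecondCountableTopology P) (_ : ChartedSpace (EuclideanSpace ℝ (Fin 4)) P) (_ : IsManifold (𝓡 4) ∞ P), Literature.Topology.FourManifolds.IsConnectedSum (𝓡 4) (𝓡 4) (𝓡 4) M Literature.Topology.FourManifolds.ComplexProjectivePlane P ∧ Nonempty (P ≃ₘ⟮𝓡 4,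 𝓡 4⟯ Literature.Topology.FourManifolds.ComplexProjectivePlane)) → Nonempty (M ≃ₘ⟮𝓡 4, 𝓡 4⟯ Metric.sphere (0 : EuclideanSpace ℝ (Fin 5)) 1) := by
  sorry

/-- row n = 2 (two-component R-links whose sphere dissolves). -/
theorem stub_row_two : open scoped ContDiff in ∀ (L : Literature.Topology.FourManifolds.FramedLink (Fin 2)) (M : Type) [TopologicalSpace M] [T2Space M] [SecondCountableTopology M] [ChartedSpace (EuclideanSpace ℝ (Fin 4)) M] [IsManifold (𝓡 4) ∞ M], Literature.Topology.FourManifolds.IsRLinkSphere M L → (∃ (P : Type) (_ : TopologicalSpace P) (_ : T2Space P) (_ : SecondCountableTopology P) (_ : ChartedSpace (EuclideanSpace ℝ (Fin 4)) P) (_ : IsManifold (𝓡 4) ∞ P), Literature.Topology.FourManifolds.IsConnectedSum (𝓡 4) (𝓡 4) (𝓡 4) M Literature.Topology.FourManifolds.ComplexProjectivePlane P ∧ Nonempty (P ≃ₘ⟮𝓡 4, 𝓡 4⟯ Literature.Topology.FourManifolds.ComplexProjectivePlane)) → Nonempty (M ≃ₘ⟮𝓡 4, 𝓡 4⟯ Metric.sphere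 (0 : EuclideanSpace ℝ (Fin 5)) 1) := by
  sorry

/-- n ≥ 3: ℂℙ²-stable descent to at most two components. -/
theorem stub_stable_descent : open scoped ContDiff in ∀ (n : ℕ), 3 ≤ n → ∀ (L : Literature.Topology.FourManifolds.FramedLink (Fin n)) (M : Type) [TopologicalSpace M] [T2Space M] [SecondCountableTopology M] [ChartedSpace (EuclideanSpace ℝ (Fin 4)) M] [IsManifold (𝓡 4) ∞ M], Literature.Topology.FourManifolds.IsRLinkSphere M L → (∃ (P : Type) (_ : TopologicalSpace P) (_ : T2Space P) (_ : SecondCountableTopology P) (_ : ChartedSpace (EuclideanSpace ℝ (Fin 4)) P) (_ : IsManifold (𝓡 4) ∞ P), Literature.Topology.FourManifolds.IsConnectedSum (𝓡 4) (𝓡 4) (𝓡 4) M Literature.Topology.FourManifolds.ComplexProjectivePlane P ∧ Nonempty (P ≃ₘ⟮𝓡 4, 𝓡 4⟯ Literature.Topology.FourManifolds.ComplexProjectivePlane)) → ∃ (k : ℕ) (L' : Literature.Topology.FourManifolds.FramedLink (Fin k)), k ≤ 2 ∧ Literature.Topology.FourManifolds.IsRLinkSphere M L' := by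
  sorry

/-- COMPOSITION (real proof, no sorry; W1 form): the three registered stubs give the ROUTE crux BY NAME. -/
theorem GscCP2Cancellation_of :
    Summit.SmoothPoincare4.SmoothPoincare4.Theses.RootDecompY.GscCP2Cancellation := by
  intro n L M _ _ _ _ _ hM hd
  have key : ∀ (k : ℕ), k ≤ 2 → ∀ (L' : FramedLink (Fin k)), IsRLinkSphere M L' →
      Nonempty (M ≃ₘ⟮𝓡 4, 𝓡 4⟯ Metric.sphere (0 : EuclideanSpace ℝ (Fin 5)) 1) := by
    intro k hk L' hM'
    rcases Nat.lt_or_ge k 2 with hlt | hge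
    · exact stub_floor_le_one k (by omega) L' M hM' hd
    · obtain rfl : k = 2 := le_antisymm hk hge
      exact stub_row_two L' M hM' hd
  rcases Nat.lt_or_ge n 3 with hlt | hge
  · exact key n (by omega) L hM
  · obtain ⟨k, L', hk, hM'⟩ := stub_stable_descent n hge L M hM hd
    exact key k hk L' hM'

end Summit.SmoothPoincare4.SmoothPoincare4.Cruxes.GscCP2Cancellation.Unimax
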